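import Mathlib

/-!
# Cyclic continuants, strings and the T/S cofactor pieces (crux `ValuativeGCT.ValuativeFlip`, stub `stub_fourRowPencilRank`)

Objects of the cyclic-tridiagonal architecture for hypothesis `H` of
`fourRowPencilRank_of_pencilCertificate` (`Cruxes/ValuativeFlip/AxisK9G1a2CyclicTridiagonal.md`
§1), over an arbitrary commutative ring `R` with three sequences `l m m' : ZMod n → R` (loops,
clockwise and counter-clockwise forms of the cyclic tridiagonal matrix
`A r r = l r`, `A r (r+1) = m r`, `A r (r-1) = m' r`):

* `kont l m m' a L` — the CONTINUANT (monomer–dimer polynomial) of the arc `a, a+1, …, a+L-1`,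
  by the right-end recursion `K(a,L+2) = l_{a+L+1} K(a,L+1) + m_{a+L} m'_{a+L+1} K(a,L)`,
  `K(a,0) = 1`, `K(a,1) = l_a`; `kont_rec` (recursion with the indices supplied as equations),
  `kont_left` (the left-end recursion `K(a,L+2) = l_a K(a+1,L+1) + m_a m'_{a+1} K(a+2,L)`);
* `cstr m a e = m_a m_{a+1} ⋯ m_{a+e-1}` — strings; `cstr_succ`, `cstr_succ_left`;
* `Tw l m m' q e = cstr m q e · K(q+e+1, n-1-e)` and `Sw l m m' q e = cstr m' (q+1) e · K(q+e+1, n-1-e)`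
  — the clockwise / counter-clockwise cofactor pieces attached to the window `[q, q+e]`
  (`T_{q+e,q}` and `S_{q,q+e}` of the AXIS note; the cofactor formula `F = T + S` is file
  `…CyclicCofactor`, the membership chains are file `…CyclicMembership`).

[this crux; classical objects (continuants: Muir; monomer–dimer polynomials)]
-/

set_option linter.dupNamespace false

namespace Summit.ValiantsHypothesis.ValiantsHypothesis.Theorems.ValuativeFlip

open scoped BigOperators

section defs

variable {R : Type*} [CommRing R] {n : ℕ}

/-- The continuant of the arc `a, …, a+L-1` (right-end recursion). [classical] -/
def kont (l m m' : ZMod n → R) (a : ZMod n) : ℕ → R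
  | 0 => 1
  | 1 => l a
  | (L + 2) => l (a + ((L + 1 : ℕ) : ZMod n)) * kont l m m' a (L + 1) +
      m (a + (L : ZMod n)) * m' (a + ((L + 1 : ℕ) : ZMod n)) * kont l m m' a L

/-- The string `m_a m_{a+1} ⋯ m_{a+e-1}`. [this crux] -/
def cstr (m : ZMod n → R) (a : ZMod n) (e : ℕ) : R := ∏ s ∈ Finset.range e, m (a + (s : ZMod n))

/-- The clockwise cofactor piece of the window `[q, q+e]`: `T_{q+e,q} = m_q ⋯ m_{q+e-1} · K(q+e+1, n-1-e)`.
[this crux] -/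
def Tw (l m m' : ZMod n → R) (q : ZMod n) (e : ℕ) : R :=
  cstr m q e * kont l m m' (q + ((e + 1 : ℕ) : ZMod n)) (n - 1 - e)

/-- The counter-clockwise cofactor piece of the window `[q, q+e]`:
`S_{q,q+e} = m'_{q+1} ⋯ m'_{q+e} · K(q+e+1, n-1-e)`. [this crux] -/
def Sw (l m m' : ZMod n → R) (q : ZMod n) (e : ℕ) : R :=
  cstr m' (q + 1) e * kont l m m' (q + ((e + 1 : ℕ) : ZMod n)) (n - 1 - e)

end defs

section lemmas

variable {R : Type*} [CommRing R] {n : ℕ} (l m m' : ZMod n → R)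

/-- `K(a,0) = 1`. -/
@[simp] theorem kont_zero (a : ZMod n) : kont l m m' a 0 = 1 := rfl

/-- `K(a,1) = l_a`. -/
@[simp] theorem kont_one (a : ZMod n) : kont l m m' a 1 = l a := rfl

/-- The defining right-end recursion. -/
theorem kont_add_two (a : ZMod n) (L : ℕ) :
    kont l m m' a (L + 2) = l (a + ((L + 1 : ℕ) : ZMod n)) * kont l m m' a (L + 1) +
      m (a + (L : ZMod n)) * m' (a + ((L + 1 : ℕ) : ZMod n)) * kont l m m' a L := rfl

/-- The right-end recursion with the indices supplied as equations (robust rewriting form):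
`K(a,L+2) = l_b K(a,L+1) + m_c m'_b K(a,L)` for `b = a+L+1`, `c = a+L`. [classical] -/
theorem kont_rec (a : ZMod n) (L : ℕ) {b c : ZMod n} (hb : b = a + (L : ZMod n) + 1)
    (hc : c = a + (L : ZMod n)) :
    kont l m m' a (L + 2) = l b * kont l m m' a (L + 1) + m c * m' b * kont l m m' a L := by
  subst hb; subst hc
  rw [kont_add_two]
  push_cast
  ring_nf

/-- **Left-end recursion** `K(a,L+2) = l_a K(a+1,L+1) + m_a m'_{a+1} K(a+2,L)`. [classical] -/
theorem kont_left (a : ZMod n) (L : ℕ) :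
    kont l m m' a (L + 2) = l a * kont l m m' (a + 1) (L + 1) +
      m a * m' (a + 1) * kont l m m' (a + 2) L := by
  induction L using Nat.twoStepInduction generalizing a with
  | zero =>
    show kont l m m' a 2 = l a * kont l m m' (a + 1) 1 + m a * m' (a + 1) * kont l m m' (a + 2) 0
    have e1 : kont l m m' a 2 = l (a + 1) * kont l m m' a 1 + m a * m' (a + 1) * kont l m m' a 0 :=
      kont_rec l m m' a 0 (by push_cast; ring) (by push_cast; ring)
    rw [e1]
    simp only [kont_one, kont_zero]
    ring
  | one =>
    show kont l m m' a 3 = l a * kont l m m' (a + 1) 2 + m a * m' (a + 1) * kont l m m' (a + 2) 1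
    have e1 : kont l m m' a 3 = l (a + 2) * kont l m m' a 2 + m (a + 1) * m' (a + 2) * kont l m m' a 1 :=
      kont_rec l m m' a 1 (by push_cast; ring) (by push_cast; ring)
    have e2 : kont l m m' a 2 = l (a + 1) * kont l m m' a 1 + m a * m' (a + 1) * kont l m m' a 0 :=
      kont_rec l m m' a 0 (by push_cast; ring) (by push_cast; ring)
    have e3 : kont l m m' (a + 1) 2 =
        l (a + 2) * kont l m m' (a + 1) 1 + m (a + 1) * m' (a + 2) * kont l m m' (a + 1) 0 :=
      kont_rec l m m' (a + 1) 0 (by push_cast; ring) (by push_cast; ring)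
    rw [e1, e2, e3]
    simp only [kont_one, kont_zero]
    ring
  | more L ih1 ih2 =>
    show kont l m m' a (L + 4) = l a * kont l m m' (a + 1) (L + 3) +
      m a * m' (a + 1) * kont l m m' (a + 2) (L + 2)
    have eA : kont l m m' a (L + 4) = l (a + ((L + 3 : ℕ) : ZMod n)) * kont l m m' a (L + 3) +
        m (a + ((L + 2 : ℕ) : ZMod n)) * m' (a + ((L + 3 : ℕ) : ZMod n)) * kont l m m' a (L + 2) :=
      kont_rec l m m' a (L + 2) (by push_cast; ring) (by push_cast; ring)
    have eB : kont l m m' a (L + 3) = l a * kont l m m' (a + 1) (L + 2) +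
        m a * m' (a + 1) * kont l m m' (a + 2) (L + 1) := ih2 a
    have eC : kont l m m' a (L + 2) = l a * kont l m m' (a + 1) (L + 1) +
        m a * m' (a + 1) * kont l m m' (a + 2) L := ih1 a
    have eD : kont l m m' (a + 1) (L + 3) =
        l (a + ((L + 3 : ℕ) : ZMod n)) * kont l m m' (a + 1) (L + 2) +
        m (a + ((L + 2 : ℕ) : ZMod n)) * m' (a + ((L + 3 : ℕ) : ZMod n)) * kont l m m' (a + 1) (L + 1) :=
      kont_rec l m m' (a + 1) (L + 1) (by push_cast; ring) (by push_cast; ring)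
    have eE : kont l m m' (a + 2) (L + 2) =
        l (a + ((L + 3 : ℕ) : ZMod n)) * kont l m m' (a + 2) (L + 1) +
        m (a + ((L + 2 : ℕ) : ZMod n)) * m' (a + ((L + 3 : ℕ) : ZMod n)) * kont l m m' (a + 2) L :=
      kont_rec l m m' (a + 2) L (by push_cast; ring) (by push_cast; ring)
    rw [eA, eB, eC, eD, eE]
    ring

/-- The left-end recursion with the indices supplied as equations. [classical] -/
theorem kont_left_rec (a : ZMod n) (L : ℕ) {b c : ZMod n} (hb : b = a + 1) (hc : c = a + 2) :
    kont l m m' a (L + 2) = l a * kont l m m' b (L + 1) + m a * m' b * kont l m m' c L := by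
  subst hb; subst hc
  exact kont_left l m m' a L

/-- `cstr m a 0 = 1`. -/
@[simp] theorem cstr_zero (a : ZMod n) : cstr m a 0 = 1 := by simp [cstr]

/-- Right extension of a string: `cstr m a (e+1) = cstr m a e * m_{a+e}`. [this crux] -/
theorem cstr_succ (a : ZMod n) (e : ℕ) : cstr m a (e + 1) = cstr m a e * m (a + (e : ZMod n)) := by
  simp [cstr, Finset.prod_range_succ]

/-- Left extension of a string: `cstr m a (e+1) = m_a * cstr m (a+1) e`. [this crux] -/
theorem cstr_succ_left (a : ZMod n) (e : ℕ) :
    cstr m a (e + 1) = m a * cstr m (a + 1) e := by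
  unfold cstr
  rw [Finset.prod_range_succ']
  simp only [Nat.cast_zero, add_zero, Nat.cast_succ]
  rw [mul_comm]
  congr 1
  refine Finset.prod_congr rfl fun s _ => ?_
  congr 1
  ring

/-- Strings with the start supplied as an equation. [this crux] -/
theorem cstr_congr {a b : ZMod n} (h : a = b) (e : ℕ) : cstr m a e = cstr m b e := by rw [h]

end lemmas

end Summit.ValiantsHypothesis.ValiantsHypothesis.Theorems.ValuativeFlip
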